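import Summits.QuantumAdvantage.QuantumAdvantage.Theses.ArithStatLadder
import Literature.Computability.Cryptography.HallgrenClassGroup
import Literature.Computability.Cryptography.HallgrenPell
import Literature.NumberTheory.LFunctions.UniformClassGroupPNT
import Literature.NumberTheory.LFunctions.UniformClassGroupPNTGeneralDegree
import Literature.NumberTheory.LFunctions.LandauPageRealZeros

/-!
# Sketch for crux `IqThreeMemBQP` (stmt-QuantumAdvantage-2424) — idea cards `mirror-dodge` and
# `cubic-escape` (planner cruxidea-2424-2, round 1)

First lemmas of the line "Spiegelung beats Siegel":

* `sum_eq_zero_of_index_three` / `IndexThreeRelativeEscape` — for an index-3 subgroup `M` of the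
  class group of a QUADRATIC field, prime ideals escape `M` with relative frequency `→ 2/3`
  UNCONDITIONALLY (the Landau–Siegel term of Thorner–Zaman Thm 1.4 rescales the classes inside and
  outside `M` by the same factor, because a real class-group character is trivial or of order 2 and
  an order-2 character has zero sum on an index-3 subgroup).
* `mirror_not_both_dark` — Landau 1918 (PROVED in the tree, MV Thm 11.7): the Kronecker characters
  of `K = ℚ(√−d)` and of its Scholz mirror `F = ℚ(√3d)` cannot both have a real zero near `1`.
* `ScholzMirrorCriterion` / `ScholzMirrorCriterion₃` — Scholz 1932 refined by Kummer theory: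
  `3 ∣ h(−d) ↔ 3 ∣ h(F) ∨ ε_F is 3-primary`, the primarity being a congruence on the fundamental
  unit (`3 ∣ b` for `ε = (a + b√3m)/2` when `3 ∤ d`; `ε⁸ ≡ 1 (mod 9𝒪_F)` when `3 ∣ d`), hence
  readable from the PROVED tree facts `Hallgren2007_regulator_qsolvable` (GRH-free regulator) and
  `JacobsonWilliams2008_unitResidue_mem_FP` (unit mod m from ⌊R⌋).
* `RealQuadraticPrimeClassOrderQSolvable` — the one GRH-free quantum primitive on the real side
  (order of ONE ideal class of a real quadratic field: Hallgren 2005/2007, 2-dim continuous HSP).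
-/

noncomputable section

open scoped BigOperators Classical nonZeroDivisors

set_option linter.dupNamespace false

namespace Summit.QuantumAdvantage.QuantumAdvantage.Cruxes.IqThreeMemBQP.MirrorDodge

open _root_.Computability Literature.Computability.Complexity Literature.Computability.Cryptography
open Literature.NumberTheory.QuadraticFields Literature.NumberTheory.LFunctions.NumberField
open Literature.NumberTheory.LFunctions.DirichletZFR
open NumberField

/-! ### 1. The algebra behind cubic escape -/

/-- An order-2 character of a finite abelian group is nontrivial on every subgroup of index 3,
hence has zero sum there. (If `χ|_M = 1` then `χ` factors through `G/M ≅ C₃`, so `χ³ = 1 = χ²`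
forces `χ = 1`.) [folklore] -/
theorem restrict_ne_one_of_index_three {G : Type*} [CommGroup G] [Finite G] (χ : G →* ℂˣ)
    (h2 : χ * χ = 1) (hχ : χ ≠ 1) (M : Subgroup G) (hM : M.index = 3) :
    χ.restrict M ≠ 1 := by
  intro hres
  apply hχ
  ext g
  -- g ^ 3 ∈ M since [G : M] = 3
  have hg3 : g ^ 3 ∈ M := by
    have := Subgroup.pow_index_mem M g
    rwa [hM] at this
  have h1 : χ (g ^ 3) = 1 := by
    have := DFunLike.congr_fun hres ⟨g ^ 3, hg3⟩
    simpa using this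
  have hsq : χ g * χ g = 1 := by
    have := DFunLike.congr_fun h2 g
    simpa using this
  have hcube : χ g ^ 3 = 1 := by rw [← map_pow]; exact h1
  have : χ g = 1 := by
    have h3 : χ g ^ 3 = χ g * (χ g * χ g) := pow_three (χ g)
    rw [hsq, mul_one] at h3
    rw [← h3, hcube]
  simpa using this

/-- **Cubic escape, relative form (quadratic fields, both signatures).** There are absolute
`C, c > 0` such that for every quadratic field `K`, every `x ≥ (4|d_K|)^C` and every subgroup `M`
of `Cl(K)` of index `3`, at least `(2/3 − e^{−c·(log x)/(log 4|d_K|)} − …)`, here weakened to the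
fixed fraction `5/9`, of the prime ideals of norm `≤ x` have class OUTSIDE `M`:
`9 · Σ_{C ∉ M} π_C(x) ≥ 5 · Σ_C π_C(x)`. Claimed consequence of
`ThornerZaman2019_classPNT_hilbertClassField` ALONE (no Stark, no Siegel hypothesis): in the
exceptional branch the factor `Li x − χ₁(C) Li x^{β₁}` is CONSTANT on `M`-cosets… more precisely
`Σ_{C∈M} χ₁(C) = 0 = Σ_{C∉M} χ₁(C)·(−1/2)·…` by `restrict_ne_one_of_index_three` when `χ₁ ≠ 1`, and
`χ₁(C) = 1` for all `C` when `χ₁ = 1` (the dark case): either way inside : outside = 1 : 2 in the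
main terms, with a multiplicative error. [this work; cite: ThornerZaman2019, Thm 1.4] -/
def IndexThreeRelativeEscape : Prop :=
  ∃ C : ℝ, 0 < C ∧ ∀ (K : Type) [Field K] [NumberField K], Module.finrank ℚ K = 2 →
    ∀ x : ℝ, ThornerZaman.condQn K ^ C ≤ x →
      ∀ M : Subgroup (ClassGroup (𝓞 K)), M.index = 3 →
        5 * (∑ Ccl : ClassGroup (𝓞 K), (primeIdealClassCount K Ccl x : ℝ)) ≤
          9 * ∑ Ccl ∈ (Finset.univ : Finset (ClassGroup (𝓞 K))).filter (fun Ccl => Ccl ∉ M),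
            (primeIdealClassCount K Ccl x : ℝ)

/-- The claimed derivation (first stub of the line). [this work] -/
def IndexThreeRelativeEscape_of_TZ : Prop :=
  ThornerZaman2019_classPNT_hilbertClassField → IndexThreeRelativeEscape

/-! ### 2. Landau–Page: a field and its mirror are never both dark (PROVED instance of MV Thm 11.7) -/

/-- Two DISTINCT primitive quadratic conductors cannot both carry a real zero in
`(1 − c/log(4 q₁ q₂), 1)`; applied to `q₁ = d` (character of `ℚ(√−d)`) and `q₂ ∈ {3d, 12d, d/3, 4d/3}`
(character of the Scholz mirror `ℚ(√3d)`), at most one of the two fields is "dark".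
[cite: MontgomeryVaughan2007, Thm 11.7] [cite: Landau1918] -/
theorem mirror_not_both_dark :
    ∃ c : ℝ, 0 < c ∧ ∀ (q₁ q₂ : ℕ) [NeZero q₁] [NeZero q₂]
      (χ₁ : DirichletCharacter ℂ q₁) (χ₂ : DirichletCharacter ℂ q₂),
      χ₁.IsPrimitive → χ₂.IsPrimitive → χ₁ ≠ 1 → χ₂ ≠ 1 → χ₁ ^ 2 = 1 → χ₂ ^ 2 = 1 → q₁ ≠ q₂ →
      ∀ β₁ β₂ : ℝ, χ₁.LFunction β₁ = 0 → χ₂.LFunction β₂ = 0 →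
        min β₁ β₂ ≤ 1 - c / (Real.log ((q₁ : ℝ) * q₂) + Real.log 4) := by
  obtain ⟨c, hc, H⟩ := exists_landau_prodChar_min_le
  refine ⟨c, hc, fun q₁ q₂ _ _ χ₁ χ₂ hp₁ hp₂ h₁ h₂ hsq₁ hsq₂ hne β₁ β₂ hz₁ hz₂ => ?_⟩
  exact H q₁ q₂ χ₁ χ₂ h₁ h₂ hsq₁ hsq₂ (prodChar_ne_one_of_isPrimitive χ₁ hp₁ χ₂ hp₂ hsq₂ hne)
    β₁ β₂ hz₁ hz₂

/-! ### 3. Scholz's mirror theorem, refined (the hinge of the line) -/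

/-- The squarefree kernel `m` of a negative fundamental discriminant `−d`: `d = m` or `d = 4m`.
[folklore] -/
def kernel (d : ℕ) : ℕ := if 4 ∣ d then d / 4 else d

/-- "`(a, b)` is the least solution of `a² − D b² = ±4` with `b > 0`", i.e. `ε_D = (a + b√D)/2` is the
fundamental unit `> 1` of `ℚ(√D)` for square-free `D` — verbatim the arithmetic description used by
the tree fact `JacobsonWilliams2008_unitResidue_mem_FP`. [cite: JacobsonWilliams2008, Ch. 12] -/
def IsFundUnitPair (D a b : ℕ) : Prop :=
  0 < b ∧ ((a : ℤ) ^ 2 - (D : ℤ) * (b : ℤ) ^ 2 = 4 ∨ (a : ℤ) ^ 2 - (D : ℤ) * (b : ℤ) ^ 2 = -4) ∧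
    ∀ a' b' : ℕ, 0 < b' →
      ((a' : ℤ) ^ 2 - (D : ℤ) * (b' : ℤ) ^ 2 = 4 ∨ (a' : ℤ) ^ 2 - (D : ℤ) * (b' : ℤ) ^ 2 = -4) → a ≤ a'

/-- **Scholz 1932, refined (case `3 ∤ d`).** For a negative fundamental discriminant `−d`, `d > 4`,
`3 ∤ d`, with mirror field `F = ℚ(√3m)` (`m` the square-free kernel of `d`) and fundamental unit
`ε_F = (a + b√3m)/2`:  `3 ∣ h(−d) ↔ (3 ∣ h(F) ∨ 3 ∣ b)`.
(Scholz: `r₃(F) ≤ r₃(−d) ≤ r₃(F) + 1`; Kummer theory over `ℚ(√−d, √−3)`: the unramified cubic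
extensions of `ℚ(√−d)` are generated by the 3-PRIMARY elements of `⟨ε_F⟩ ⊕ {3-virtual units of F}`,
and `ε_F` is 3-primary iff `ε_F ≡ ±1 (mod 3𝔮)`, `𝔮² = (3)`, iff `3 ∣ b`.) Numerically tested by kit
jobs j009195/j009197. `h(−d)` is the tree's `BinaryQuadraticForm.classNumber`, `h(F)` Mathlib's
`NumberField.classNumber`. [cite: Scholz1932] [cite: Buell1989, Thm 8.6] [this work: unit form] -/
def ScholzMirrorCriterion : Prop :=
  ∀ d : ℕ, IsNegFundamentalDiscr d → 4 < d → ¬ 3 ∣ d →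
    ∀ (F : Type) [Field F] [NumberField F], Module.finrank ℚ F = 2 →
      (∃ α : F, α ^ 2 = ((3 * kernel d : ℕ) : F)) →
        ∀ a b : ℕ, IsFundUnitPair (3 * kernel d) a b →
          (3 ∣ BinaryQuadraticForm.classNumber (-(d : ℤ)) ↔
            3 ∣ NumberField.classNumber F ∨ 3 ∣ b)

/-- **Scholz 1932, refined (case `3 ∣ d`).** Mirror field `F = ℚ(√m')`, `m' = m/3` coprime to `3`,
`ε_F = (a + b√m')/2`; primarity at the primes above `3` of `F(√−3)` reads `ε_F⁸ ≡ 1 (mod 9𝒪_F)`, i.e.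
with `z = a + b√m' = 2ε_F ∈ ℤ[√m']`: `z⁸ ≡ 256 (mod 9ℤ[√m'])`. Then `3 ∣ h(−d) ↔ (3 ∣ h(F) ∨ that
congruence)`. [cite: Scholz1932] [this work: unit form] -/
def ScholzMirrorCriterion₃ : Prop :=
  ∀ d : ℕ, IsNegFundamentalDiscr d → 12 < d → 3 ∣ d →
    ∀ (F : Type) [Field F] [NumberField F], Module.finrank ℚ F = 2 →
      (∃ α : F, α ^ 2 = ((kernel d / 3 : ℕ) : F)) →
        ∀ a b : ℕ, IsFundUnitPair (kernel d / 3) a b →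
          (3 ∣ BinaryQuadraticForm.classNumber (-(d : ℤ)) ↔
            3 ∣ NumberField.classNumber F ∨
              ((9 : ℤ) ∣ ((⟨a, b⟩ : ℤ√((kernel d / 3 : ℕ) : ℤ)) ^ 8).re - 256 ∧
                (9 : ℤ) ∣ ((⟨a, b⟩ : ℤ√((kernel d / 3 : ℕ) : ℤ)) ^ 8).im))

/-! ### 4. The one GRH-free quantum primitive needed on the real side -/

/-- **Order of ONE ideal class of a real quadratic field in quantum polynomial time, no GRH**
(Hallgren 2005/2007: the class-group algorithm restricted to a single given generator is a hidden
subgroup problem in `ℤ × ℝ`; GRH enters the printed theorem only to make `poly(log D)` prime ideals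
GENERATE). Input `⟨bin D, ⟨bin p, bin r⟩⟩` with `D ≥ 2` square-free, `p` prime, `p ∣ r² − D`
(so `𝔭 = (p, r + √D)` is a prime of `F = ℚ(√D)` above `p`); output `bin (ord [𝔭])` as a prefix.
[cite: Hallgren2007] [cite: Hallgren2005] [cite: BiasseSong2015] -/
def RealQuadraticPrimeClassOrderQSolvable : Prop :=
  IsQSolvable fun x : List Bool =>
    {y | ∀ (F : Type) [Field F] [NumberField F] (D p r : ℕ) (α : 𝓞 F),
      x = boolPair (encodeNat D) (boolPair (encodeNat p) (encodeNat r)) →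
        Squarefree D → 2 ≤ D → Module.finrank ℚ F = 2 → (α : F) ^ 2 = (D : F) → p.Prime →
          (p : ℤ) ∣ (r : ℤ) ^ 2 - D →
            ∀ hI : Ideal.span {(p : 𝓞 F), (r : 𝓞 F) + α} ∈ (Ideal (𝓞 F))⁰,
              encodeNat (orderOf (ClassGroup.mk0 ⟨_, hI⟩)) <+: y}

/-! ### 5. The shape of the line (composition target for crux-plan; NOT proved here) -/

/-- The skeleton the idea card proposes: cubic escape + the two Scholz criteria + the real-side
order primitive (+ in-tree PROVED: Landau `mirror_not_both_dark`, `Hallgren2007_regulator_qsolvable`,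
`JacobsonWilliams2008_unitResidue_mem_FP_holds`, `factoring_mem_FBQP`, Shor order finding) give the
crux. [this work] -/
def MirrorDodgeLine : Prop :=
  IndexThreeRelativeEscape → ScholzMirrorCriterion → ScholzMirrorCriterion₃ →
    RealQuadraticPrimeClassOrderQSolvable →
      Summit.QuantumAdvantage.QuantumAdvantage.Theses.ArithStatLadder.IqThreeMemBQP

end Summit.QuantumAdvantage.QuantumAdvantage.Cruxes.IqThreeMemBQP.MirrorDodge

end
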